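import Mathlib
import Literature.Barriers.ValiantsHypothesis.AlgebraicNaturalProofs
import Literature.Computability.AlgebraicComplexity.ApolarityAction
import Summits.ValiantsHypothesis.ValiantsHypothesis.Theorems.BarrierLeverSuccinctHittingSetsForVPLowSupport
import Summits.ValiantsHypothesis.ValiantsHypothesis.Theorems.BarrierLeverSuccinctHittingSetsForVPStubSparseGlue
import Summits.ValiantsHypothesis.ValiantsHypothesis.Theorems.BarrierLeverSuccinctHittingSetsForVPStubDerivDimension
import Summits.ValiantsHypothesis.ValiantsHypothesis.Theorems.BarrierLeverSuccinctHittingSetsForVPStubLowPartialsHit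
import Summits.ValiantsHypothesis.ValiantsHypothesis.Theorems.BarrierLeverSuccinctHittingSetsForVPStubSigmaLambdaSigma
import HarnessLib

/-!
# Crux `BarrierLever.SuccinctHittingSetsForVP` (stmt-ValiantsHypothesis-14610), line `registered` —
DISTINGUISHERS WITH FEW PARTIAL DERIVATIVES ARE HIT (in particular `ΣΛΣ`), AND NATURAL PROOFS
AGAINST `VP` HAVE EXPONENTIALLY MANY LINEARLY INDEPENDENT PARTIAL DERIVATIVES

**What is proved (unconditional; structure of the open stub — a further class carved out of level
one; it does NOT close the item).** Write `g ⌟ D` (`apolarAction g D`) for the action of the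
constant-coefficient differential operator `g(∂)` on a polynomial `D` in the `N = C(2n,n)`
coefficient variables, and say `D` has its partials in `V` if `g ⌟ D ∈ V` for every `g`
(`V ⊇ ∂^*(D)`, the span of all iterated partial derivatives of `D`).

* `LowPartials.isSuccinctHittingSet_finrank_lt` (wave 3 assembled: `stub_lowPartialsHit` p155623 fed
  with `stub_derivDimension` p155871): if `t(2n+2) ≤ n^b`, `SmallCircuits ℂ n b` hits every nonzero
  `D` with partials in a space of dimension `< 2^(t+1)`. Mechanism (folklore; the support-rank ideas
  of Forbes–Saptharishi–Shpilka 2014): a monomial `m` of `D` with inclusion-minimal support yields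
  `2^|supp m|` linearly independent derivatives `∂^{m|_T} D`, `T ⊆ supp m`; so few partials force a
  monomial on `≤ t` variables, which the landed `LowSupport` theorem (p147275) hits with a `t`-sparse
  small circuit.
* `isSuccinctHittingSet_lowPartials` (= registered stub `stub_lowPartials`): for every `a`, for all
  `n ≥ 8a + 1`, `SmallCircuits ℂ n 3` hits every nonzero `D` with partials in a space of dimension
  `≤ N^a` — whatever the degree and size of `D`.
* `isSuccinctHittingSet_sigmaLambdaSigma`: in particular (`stub_sigmaLambdaSigma` p155760: the partials
  of `Σ_{i<s} c_i L_i^{d_i}`, `L_i` affine forms, lie in `span{L_i^j}` of dimension `≤ Σ_i (d_i+1)`)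
  every nonzero `ΣΛΣ` distinguisher — a sum of `s` powers of affine forms in the coefficients with
  `Σ_i (d_i + 1) ≤ N^a`, i.e. every diagonal depth-3 circuit of polynomial size — is hit by
  `SmallCircuits ℂ n 3`: no Waring-type / symmetric-tensor-rank expression of polynomial size is an
  algebraically natural proof against `VP`.
* DUALLY `LowPartials.two_pow_lt_finrank_of_vanishes`, `two_pow_lt_finrank_of_isNaturalProof`:
  for `n ≥ 3`, `b ≥ 2`, the partial derivatives of an equation of `SmallCircuits ℂ n b` (an
  algebraically natural proof against size `n^b`, FSV Def. 1, any `𝒟`) span MORE than `2^(n^(b-2))`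
  dimensions: a natural proof against `VP` is itself exponentially complex for the partial-derivative
  measure of Nisan–Wigderson.

Axioms: `propext`, `Classical.choice`, `Quot.sound`. References: [ForbesShpilkaVolk2018] Def. 1,
Question 6, Thm. 9 (the programme of carving restricted `𝒟`); the dimension-of-partials measure is
Nisan–Wigderson's (1996); the minimal-support/independence lemma is folklore.
-/

-- layout Summits/ValiantsHypothesis/ValiantsHypothesis forces the duplicated namespace component
set_option linter.dupNamespace false

namespace Summit.ValiantsHypothesis.ValiantsHypothesis.Theorems.BarrierLever.SuccinctHittingSetsForVP

open Literature.Barriers.ValiantsHypothesis Literature.Computability.AlgebraicComplexity MvPolynomial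

namespace LowPartials

variable {n : ℕ}

/-- **Few partials ⇒ hit** (wave 3 assembled, unconditional): if `t(2n+2) ≤ n^b`, the coefficient
vectors of `SmallCircuits ℂ n b` hit every nonzero `D` whose partial derivatives all lie in a space of
dimension `< 2^(t+1)`. [folklore] -/
theorem isSuccinctHittingSet_finrank_lt {t b : ℕ} (h : t * (2 * n + 2) ≤ n ^ b) :
    IsSuccinctHittingSet (degLEMonomials n) (SmallCircuits ℂ n b)
      {D | ∃ V : Submodule ℂ (MvPolynomial (degLEMonomials n) ℂ), FiniteDimensional ℂ V ∧
        Module.finrank ℂ V < 2 ^ (t + 1) ∧ ∀ g, apolarAction g D ∈ V} :=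
  stub_lowPartialsHit stub_derivDimension n t b h

/-- The budget: for `n ≥ 8a + 1`, `2an(2n+2) ≤ n³`. [folklore] -/
theorem budget {a n : ℕ} (hn : 8 * a + 1 ≤ n) : 2 * a * n * (2 * n + 2) ≤ n ^ 3 := by
  have h2 : 2 * n + 2 ≤ 4 * n := by omega
  calc 2 * a * n * (2 * n + 2) ≤ 2 * a * n * (4 * n) := Nat.mul_le_mul_left _ h2
    _ = 8 * a * (n * n) := by ring
    _ ≤ n * (n * n) := Nat.mul_le_mul_right _ (by omega)
    _ = n ^ 3 := by ring

/-- **Dually: the partials of an equation span exponentially many dimensions.** For `n ≥ 3`, `b ≥ 2`: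
if a nonzero `D` vanishes at `coeff f` for every `f ∈ SmallCircuits ℂ n b` and all its partials lie in
a finite-dimensional `V`, then `2^(n^(b-2)) < dim V`. [folklore] -/
theorem two_pow_lt_finrank_of_vanishes {b : ℕ} (hn : 3 ≤ n) (hb : 2 ≤ b)
    {D : MvPolynomial (degLEMonomials n) ℂ} (hD0 : D ≠ 0)
    (hvan : ∀ f ∈ SmallCircuits ℂ n b, eval (coeffVector (degLEMonomials n) f) D = 0)
    {V : Submodule ℂ (MvPolynomial (degLEMonomials n) ℂ)} (hVfd : FiniteDimensional ℂ V)
    (hVmem : ∀ g, apolarAction g D ∈ V) :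
    2 ^ (n ^ (b - 2)) < Module.finrank ℂ V := by
  obtain ⟨m, hm, hmin⟩ := LowPartialsHit.exists_support_minimal hD0
  have hwide : n ^ (b - 2) < m.support.card := card_support_gt_of_vanishes hn hb hvan hm
  have hdim : 2 ^ m.support.card ≤ Module.finrank ℂ V :=
    stub_derivDimension (degLEMonomials n) D m hm hmin V hVfd fun v _ => hVmem _
  exact lt_of_lt_of_le (Nat.pow_lt_pow_right (by norm_num) hwide) hdim

end LowPartials

open LowPartials

/-- **Distinguishers with polynomially many partial derivatives are hit.** For every `a` there is
`n₀` (`= 8a + 1`) such that for all `n ≥ n₀` the coefficient vectors of `SmallCircuits ℂ n 3` hit every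
nonzero polynomial in the `N = C(2n,n)` coefficient variables whose partial derivatives lie in a space
of dimension `≤ N^a` (any degree, any size). [folklore] -/
theorem isSuccinctHittingSet_lowPartials :
    ∀ a : ℕ, ∃ n₀ : ℕ, ∀ n : ℕ, n₀ ≤ n →
      IsSuccinctHittingSet (degLEMonomials n) (SmallCircuits ℂ n 3)
        {D | ∃ V : Submodule ℂ (MvPolynomial (degLEMonomials n) ℂ), FiniteDimensional ℂ V ∧
          Module.finrank ℂ V ≤ Nat.choose (2 * n) n ^ a ∧ ∀ g, apolarAction g D ∈ V} := by
  intro a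
  refine ⟨8 * a + 1, fun n hn => ?_⟩
  refine (isSuccinctHittingSet_finrank_lt (t := 2 * a * n) (budget hn)).mono le_rfl ?_
  rintro D ⟨V, hVfd, hVdim, hVmem⟩
  refine ⟨V, hVfd, lt_of_le_of_lt (hVdim.trans SparseGlue.choose_pow_le) ?_, hVmem⟩
  exact Nat.pow_lt_pow_right (by norm_num) (Nat.lt_succ_self _)

/-- **Registered stub `stub_lowPartials`** (crux stmt-ValiantsHypothesis-14610, line `registered`;
wave 3 assembled): verbatim `isSuccinctHittingSet_lowPartials`. [folklore] -/
theorem stub_lowPartials :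
    ∀ a : ℕ, ∃ n₀ : ℕ, ∀ n : ℕ, n₀ ≤ n →
      IsSuccinctHittingSet (degLEMonomials n) (SmallCircuits ℂ n 3)
        {D | ∃ V : Submodule ℂ (MvPolynomial (degLEMonomials n) ℂ), FiniteDimensional ℂ V ∧
          Module.finrank ℂ V ≤ Nat.choose (2 * n) n ^ a ∧ ∀ g, apolarAction g D ∈ V} :=
  isSuccinctHittingSet_lowPartials

/-- **`ΣΛΣ` distinguishers are hit.** For every `a`, eventually in `n`, `SmallCircuits ℂ n 3` hits
every nonzero sum of powers of affine forms `Σ_{i<s} c_i (ℓ₀ᵢ + Σ_{μ∈A} ℓ_{iμ} c_μ)^{d_i}` in the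
coefficient variables with `Σ_i (d_i + 1) ≤ N^a` — diagonal depth-3 (`ΣΛΣ`, Waring-type) circuits of
polynomial size are never algebraically natural proofs against `VP`. [folklore] -/
theorem isSuccinctHittingSet_sigmaLambdaSigma :
    ∀ a : ℕ, ∃ n₀ : ℕ, ∀ n : ℕ, n₀ ≤ n →
      IsSuccinctHittingSet (degLEMonomials n) (SmallCircuits ℂ n 3)
        {D | ∃ (s : ℕ) (A : Finset (degLEMonomials n)) (c ℓ₀ : Fin s → ℂ)
            (ℓ : Fin s → degLEMonomials n → ℂ) (d : Fin s → ℕ),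
          ∑ i, (d i + 1) ≤ Nat.choose (2 * n) n ^ a ∧
          D = ∑ i : Fin s, C (c i) * (C (ℓ₀ i) + ∑ μ ∈ A, C (ℓ i μ) * X μ) ^ (d i)} := by
  intro a
  obtain ⟨n₀, h⟩ := isSuccinctHittingSet_lowPartials a
  refine ⟨n₀, fun n hn => (h n hn).mono le_rfl ?_⟩
  rintro D ⟨s, A, c, ℓ₀, ℓ, d, hsum, rfl⟩
  obtain ⟨V, hVfd, hVdim, hVmem⟩ := stub_sigmaLambdaSigma (degLEMonomials n) s A c ℓ₀ ℓ d
  exact ⟨V, hVfd, hVdim.trans hsum, hVmem⟩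

/-- **Natural proofs against `VP` have exponentially many independent partial derivatives.** For
`n ≥ 3`, `b ≥ 2`: if `D` is an algebraically natural proof against `SmallCircuits ℂ n b` (FSV Def. 1,
any distinguisher class `𝒟`) and its partial derivatives lie in a finite-dimensional `V`, then
`dim V > 2^(n^(b-2))`. [cite: ForbesShpilkaVolk2018, Def. 1] -/
theorem two_pow_lt_finrank_of_isNaturalProof {n b : ℕ} (hn : 3 ≤ n) (hb : 2 ≤ b)
    {𝒟 : Set (MvPolynomial (degLEMonomials n) ℂ)} {D : MvPolynomial (degLEMonomials n) ℂ}
    (hD : IsNaturalProof (degLEMonomials n) (SmallCircuits ℂ n b) 𝒟 D)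
    {V : Submodule ℂ (MvPolynomial (degLEMonomials n) ℂ)} (hVfd : FiniteDimensional ℂ V)
    (hVmem : ∀ g, apolarAction g D ∈ V) :
    2 ^ (n ^ (b - 2)) < Module.finrank ℂ V :=
  two_pow_lt_finrank_of_vanishes hn hb hD.2.1 hD.2.2 hVfd hVmem

end Summit.ValiantsHypothesis.ValiantsHypothesis.Theorems.BarrierLever.SuccinctHittingSetsForVP
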